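import Mathlib
import HarnessLib
import HarnessLib.Audit

/-!
# ValiantsHypothesis / LacunarySymmetroid — crux `MatrixDescartes` (stmt-ValiantsHypothesis-18050, V1), LINE (A) «product_plus_one»:
# binomial-limit TOY THEOREM, module 3 — a generalized Rolle bound for positive roots of polynomial numerators

Tool for the Laguerre transfer (Pólya–Szegő II, V.80) in pen val-idea-25 g8 NOTE §54.13.  For real polynomials `N, D` with
`D ≠ 0` on `(0, ∞)` and a real constant `c`, put `Ñ = c·N·D + N′·D − N·D′`, the numerator of `d/dY (e^{cY} N/D) = e^{cY} Ñ/D²`.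
Then the number of positive roots of `N` counted with multiplicity is at most that of `Ñ` plus one
(`card_posRoots_le_rolleNum`).  Proof = Mathlib's `Polynomial.card_roots_le_derivative` restricted to `(0, ∞)` and with
`e^{cY}/D` inserted: Rolle's theorem interleaves the distinct positive roots, and `(X − x)^{m−1} ∣ Ñ` at a root of
multiplicity `m` handles multiplicities.

HONEST FRAMING: generic helper; no stub of LINE (A) is touched; `MatrixDescartes` OPEN; `VP ≠ VNP` is NOT proved and nothing
here bears on it.
-/

set_option linter.dupNamespace false

namespace Summit.ValiantsHypothesis.ValiantsHypothesis.Theorems.LacunarySymmetroidMatrixDescartes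

namespace ToyALaw

open Polynomial Finset Set

/-- Number of roots of a real polynomial in a multiset filter, as a sum of counts over the distinct ones. -/
theorem card_filter_roots_eq_sum_count (N : ℝ[X]) (p : ℝ → Prop) [DecidablePred p] :
    Multiset.card (N.roots.filter p) = ∑ x ∈ N.roots.toFinset.filter p, N.roots.count x := by
  rw [← Multiset.toFinset_sum_count_eq, Multiset.toFinset_filter]
  refine sum_congr rfl fun x hx => ?_
  rw [Multiset.count_filter_of_pos (Finset.mem_filter.1 hx).2]

/-- The derivative of `Y ↦ e^{cY} N(Y)/D(Y)` away from the zeros of `D` is `e^{cY} Ñ(Y)/D(Y)²`,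
`Ñ = c·N·D + N′·D − N·D′`. -/
theorem hasDerivAt_exp_mul_div (c : ℝ) (N D : ℝ[X]) {y : ℝ} (hy : D.eval y ≠ 0) :
    HasDerivAt (fun y => Real.exp (c * y) * N.eval y / D.eval y)
      (Real.exp (c * y) * (C c * N * D + derivative N * D - N * derivative D).eval y / (D.eval y) ^ 2) y := by
  have h1 : HasDerivAt (fun y => Real.exp (c * y)) (Real.exp (c * y) * (c * 1)) y :=
    ((hasDerivAt_id y).const_mul c).exp
  have h := ((h1.fun_mul (N.hasDerivAt y)).fun_div (D.hasDerivAt y) hy)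
  refine h.congr_deriv ?_
  simp only [eval_add, eval_sub, eval_mul, eval_C, mul_one]
  ring

/-- If `Ñ = 0` then `e^{cY}N/D` is constant on `(0,∞)`; so either `N` has no positive root or `N = 0`.  In both cases `N`
has no positive root counted with multiplicity. -/
theorem card_posRoots_eq_zero_of_rolleNum_eq_zero (c : ℝ) (N D : ℝ[X]) (hD : ∀ y : ℝ, 0 < y → D.eval y ≠ 0)
    (h0 : C c * N * D + derivative N * D - N * derivative D = 0) :
    Multiset.card (N.roots.filter (fun y => 0 < y)) = 0 := by
  set g : ℝ → ℝ := fun y => Real.exp (c * y) * N.eval y / D.eval y with hg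
  have hderiv : ∀ y : ℝ, 0 < y → HasDerivAt g 0 y := by
    intro y hy
    have := hasDerivAt_exp_mul_div c N D (hD y hy)
    rw [h0] at this
    simpa using this
  -- g is constant on (0, ∞)
  have hconst : ∀ a b : ℝ, 0 < a → a < b → g a = g b := by
    intro a b ha hab
    have hcont : ContinuousOn g (Icc a b) := fun z hz =>
      (hderiv z (ha.trans_le hz.1)).continuousAt.continuousWithinAt
    obtain ⟨ξ, hξ, hξ'⟩ := exists_hasDerivAt_eq_slope g (fun _ => (0 : ℝ)) hab hcont
      (fun z hz => hderiv z (ha.trans hz.1))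
    have hba : b - a ≠ 0 := (sub_pos.2 hab).ne'
    have : g b - g a = 0 := by
      have := hξ'.symm
      rw [div_eq_iff hba] at this
      simpa using this
    linarith
  -- either no positive root, or N vanishes on (0,∞)
  rw [Multiset.card_eq_zero, Multiset.filter_eq_nil]
  intro y hy hypos
  by_cases hN : N = 0
  · simp [hN] at hy
  · have hroot : N.eval y = 0 := (mem_roots hN).1 hy
    have hgy : g y = 0 := by simp [hg, hroot]
    -- then N vanishes at every point of (0, ∞): infinitely many roots
    have hall : ∀ z : ℝ, 0 < z → N.eval z = 0 := by
      intro z hz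
      have hgz : g z = 0 := by
        rcases lt_trichotomy y z with h | rfl | h
        · rw [← hconst y z hypos h, hgy]
        · exact hgy
        · rw [hconst z y hz h, hgy]
      have hexp : Real.exp (c * z) ≠ 0 := (Real.exp_pos _).ne'
      have := hgz
      simp only [hg, div_eq_zero_iff, mul_eq_zero, hexp, false_or, hD z hz, or_false] at this
      exact this
    apply hN
    apply Polynomial.eq_zero_of_infinite_isRoot
    apply Set.infinite_of_not_bddAbove
    intro ⟨M, hM⟩
    have h1 : max M 1 + 1 ∈ {x | N.IsRoot x} := hall _ (by positivity)
    have := hM h1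
    linarith [le_max_left M 1]

/-- **Generalized Rolle bound on `(0, ∞)`.**  For real polynomials `N, D` with `D(y) ≠ 0` for `y > 0` and a real `c`, with
`Ñ = c·N·D + N′·D − N·D′` (so that `(e^{cY}N/D)′ = e^{cY}Ñ/D²`):
`#{positive roots of N, with multiplicity} ≤ #{positive roots of Ñ, with multiplicity} + 1`. -/
theorem card_posRoots_le_rolleNum (c : ℝ) (N D : ℝ[X]) (hD : ∀ y : ℝ, 0 < y → D.eval y ≠ 0) :
    Multiset.card (N.roots.filter (fun y => 0 < y)) ≤
      Multiset.card ((C c * N * D + derivative N * D - N * derivative D).roots.filter (fun y => 0 < y)) + 1 := by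
  set M : ℝ[X] := C c * N * D + derivative N * D - N * derivative D with hM
  by_cases hM0 : M = 0
  · rw [card_posRoots_eq_zero_of_rolleNum_eq_zero c N D hD hM0]
    exact Nat.zero_le _
  have hN0 : N ≠ 0 := by
    rintro rfl
    apply hM0
    simp [hM]
  set g : ℝ → ℝ := fun y => Real.exp (c * y) * N.eval y / D.eval y with hg
  -- distinct positive roots
  set A := N.roots.toFinset.filter (fun y => 0 < y) with hA
  set B := M.roots.toFinset.filter (fun y => 0 < y) with hB
  have hmemA : ∀ {x}, x ∈ A ↔ N.eval x = 0 ∧ 0 < x := by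
    intro x
    rw [hA, Finset.mem_filter, Multiset.mem_toFinset, mem_roots hN0, IsRoot.def]
  have hmemB : ∀ {x}, x ∈ B ↔ M.eval x = 0 ∧ 0 < x := by
    intro x
    rw [hB, Finset.mem_filter, Multiset.mem_toFinset, mem_roots hM0, IsRoot.def]
  -- (i) Rolle: distinct positive roots of N are interleaved by positive roots of M that are not roots of N
  have hinter : A.card ≤ (B \ A).card + 1 := by
    refine Finset.card_le_sdiff_of_interleaved fun x hx y hy hxy _ => ?_
    obtain ⟨hx0, hxpos⟩ := hmemA.1 hx
    obtain ⟨hy0, hypos⟩ := hmemA.1 hy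
    have hDne : ∀ z ∈ Icc x y, D.eval z ≠ 0 := fun z hz => hD z (hxpos.trans_le hz.1)
    have hcont : ContinuousOn g (Icc x y) := fun z hz =>
      (hasDerivAt_exp_mul_div c N D (hDne z hz)).continuousAt.continuousWithinAt
    have hgx : g x = 0 := by simp [hg, hx0]
    have hgy : g y = 0 := by simp [hg, hy0]
    obtain ⟨z, hz, hz'⟩ := exists_hasDerivAt_eq_zero hxy hcont (hgx.trans hgy.symm)
      (fun z hz => hasDerivAt_exp_mul_div c N D (hDne z (Ioo_subset_Icc_self hz)))
    have hzpos : 0 < z := hxpos.trans hz.1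
    have hMz : M.eval z = 0 := by
      have hexp : Real.exp (c * z) ≠ 0 := (Real.exp_pos _).ne'
      have hD2 : (D.eval z) ^ 2 ≠ 0 := pow_ne_zero 2 (hD z hzpos)
      rw [div_eq_zero_iff, mul_eq_zero] at hz'
      rcases hz' with (h | h) | h
      · exact absurd h hexp
      · exact h
      · exact absurd h hD2
    exact ⟨z, hmemB.2 ⟨hMz, hzpos⟩, hz.1, hz.2⟩
  -- (ii) multiplicities
  have hmult : ∀ x ∈ A, N.rootMultiplicity x - 1 ≤ M.rootMultiplicity x := by
    intro x _
    rw [le_rootMultiplicity_iff hM0]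
    have h1 : (X - C x) ^ (N.rootMultiplicity x - 1) ∣ N :=
      (pow_dvd_pow _ (Nat.sub_le _ _)).trans (pow_rootMultiplicity_dvd N x)
    have h2 : (X - C x) ^ (N.rootMultiplicity x - 1) ∣ derivative N := by
      rw [← le_rootMultiplicity_iff]
      · exact rootMultiplicity_sub_one_le_derivative_rootMultiplicity N x
      · intro hd
        apply hM0
        -- derivative N = 0 ⇒ N constant ⇒ M = c N D − N D' ; cannot conclude M = 0 in general: use another route
        exact False.elim (by
          -- if derivative N = 0 then N = C a with a ≠ 0, so N has no roots and A is empty; but x ∈ A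
          have hc := eq_C_of_derivative_eq_zero hd
          have : x ∈ A := by assumption
          rw [hmemA] at this
          rw [hc, eval_C] at this
          have hN : N = 0 := by rw [hc, this.1, map_zero]
          exact hN0 hN)
    rw [hM]
    exact ((h1.mul_left (C c)).mul_right D |>.add (h2.mul_right D)).sub (h1.mul_right (derivative D))
  -- (iii) bookkeeping
  calc Multiset.card (N.roots.filter (fun y => 0 < y))
      = ∑ x ∈ A, N.roots.count x := card_filter_roots_eq_sum_count N _
    _ = ∑ x ∈ A, (N.rootMultiplicity x - 1 + 1) := by
        refine sum_congr rfl fun x hx => ?_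
        rw [count_roots]
        have : 0 < N.rootMultiplicity x := by
          rw [rootMultiplicity_pos hN0]
          exact (hmemA.1 hx).1
        omega
    _ = (∑ x ∈ A, (N.rootMultiplicity x - 1)) + A.card := by
        rw [sum_add_distrib, card_eq_sum_ones]
    _ ≤ (∑ x ∈ A, M.rootMultiplicity x) + ((B \ A).card + 1) :=
        add_le_add (sum_le_sum hmult) hinter
    _ = (∑ x ∈ A, M.roots.count x) + (∑ x ∈ B \ A, 1) + 1 := by
        simp only [count_roots, card_eq_sum_ones, add_assoc]
    _ ≤ (∑ x ∈ A, M.roots.count x) + (∑ x ∈ B \ A, M.roots.count x) + 1 := by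
        gcongr with x hx
        rw [Nat.succ_le_iff, Multiset.count_pos, ← Multiset.mem_toFinset]
        exact (Finset.mem_filter.1 (Finset.mem_sdiff.1 hx).1).1
    _ = (∑ x ∈ A ∪ B, M.roots.count x) + 1 := by
        rw [← sum_union disjoint_sdiff, union_sdiff_self_eq_union]
    _ = Multiset.card (M.roots.filter (fun y => 0 < y)) + 1 := by
        rw [card_filter_roots_eq_sum_count M _, ← hB]
        congr 1
        symm
        refine sum_subset subset_union_right fun x hx hxB => ?_
        rw [Multiset.count_eq_zero]
        intro hxM
        apply hxB
        rw [hB, Finset.mem_filter, Multiset.mem_toFinset]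
        refine ⟨hxM, ?_⟩
        rcases Finset.mem_union.1 hx with h | h
        · exact (hmemA.1 h).2
        · exact (hmemB.1 h).2

end ToyALaw

end Summit.ValiantsHypothesis.ValiantsHypothesis.Theorems.LacunarySymmetroidMatrixDescartes
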